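import Literature.NumberTheory.EllipticCurves.GeomReductionFrobeniusProofs
import Literature.NumberTheory.EllipticCurves.Rank1Residual.GVParityOrdinaryLineProofs
import Literature.NumberTheory.EllipticCurves.Rank1Residual.GVParityTwistProofs
import Literature.NumberTheory.GaloisRepresentations.FrobeniusGeneration
import HarnessLib

/-!
# The decomposition group at a good ordinary prime acts on `E[p]` modulo the kernel of reduction
# through `a_p`; the "anomalous" dictionary `φ|_{G_p} ∈ {1, ω} ⟺ a_p ≡ 1 (mod p)` in the kernel

`Proofs`-style file (THEOREMS ONLY: no definition, no named fact, no instance), topic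
`NumberTheory/EllipticCurves`, cell `b2b-bsdres` (run/shared/lean/b2b/bsd-rank1-residual/), HONEST
FRAMING: the cell deletes the COMBINATION-SHAPED residual classes of the rank-`≤ 1` BSD formula from
PUBLISHED theorems only and types the rest; this is not "finishing BSD".

Castella–Grossi–Skinner, Math. Ann. 393 (2025), Thms. A/D (also CGLS 2022, Keller–Yin 2024) state the
Eisenstein hypothesis as "`φ|_{G_p} ≠ 1, ω`" (`G_p` a decomposition group at `p`, `φ` the character on
the kernel of the rational `p`-isogeny); the cell's fact `CastellaGrossiSkinner2025.thmD_…` transcribes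
it by the census predicate `¬ Rank1Residual.Anom W p` (`a_p ≢ 1 (mod p)`), flagged by the referee as a
DICTIONARY (`CGS25-anom-dictionary`). This file PROVES the dictionary at a good ORDINARY odd prime
(X1 is anomalous hence ordinary; `red ∧ good ⇒ ord` for the complement is Serre's Prop. 12):

Setting: `W/ℚ` globally minimal elliptic, `p` odd, `p ∤ Δ_W`, `p ∤ a_p`; `𝔓` the prime of `\bar ℤ`
cut out by the place `placeOver p`, `D = D_𝔓`, `I = I_𝔓 ≤ Γ_ℚ` its decomposition and inertia
groups, `σ ∈ D` an arithmetic Frobenius, `red : E(ℚ̄) → Ẽ(𝔽̄_p)` the reduction (`geomReduction`),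
`X = ker (red|E[p])` (Serre's line `X_p`).

* `natCard_ker_reduction_le` — `#X ≤ p` (the reduction is non-zero on `E[p]` at an ordinary prime);
* `smul_sub_self_mem_ker_of_mem_decompositionSubgroup_of_anom` — **if `a_p ≡ 1 (mod p)` then every
  `g ∈ D` acts trivially on `E[p]/X`** (`g P - P ∈ X`): `D` is generated, modulo the open kernel of
  `ρ̄_{E,p}`, by `I` and `σ` (tree `exists_eq_frobenius_pow_mul_of_mem_decompositionSubgroup`); `I`
  acts trivially on `E[p]/X` (`geomReduction_smul_of_mem_inertia`) and `σ` acts by `a_p ≡ 1`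
  (`geomReduction_smul_eq_frobeniusTrace_smul`, gen 6); the set of `g` with `(g - 1)E[p] ⊆ X` is
  closed under products.
* `exists_mem_inertia_smul_ne_of_mem_ker` — `X` is Serre's ordinary line (order `p`, moved by `I`).
* **`dvd_frobeniusTrace_sub_one_iff_decomposition`** — for a rational line `Φ ⊂ E[p]`:
  `a_p ≡ 1 (mod p)` **iff** (`D` fixes `Φ` pointwise — "`φ|_{G_p} = 1`") ∨ (`D` acts trivially on
  `E[p]/Φ` — "`ψ|_{G_p} = 1` for the quotient character `ψ = ω φ⁻¹`, i.e. `φ|_{G_p} = ω`").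
* `anom_iff_decomposition`, `not_anom_iff_cgs` — the same in the cell's predicates (`GoodOrd`, `2 < p`).

References: [Serre1972] §1.11 (1), Prop. 11 and Cor.; [CastellaGrossiSkinner2025] Thm. A (hypothesis
"`φ|_{G_p} ≠ 1, ω`"), §0 p. 3; [Mazur1972] §1 (anomalous primes).
-/

set_option autoImplicit false

noncomputable section

open scoped Classical NumberField Pointwise

open WeierstrassCurve Literature.NumberTheory.EllipticCurves Literature.NumberTheory.GaloisRepresentations
  Field IsDedekindDomain NumberField Rat.HeightOneSpectrum

namespace Literature.NumberTheory.EllipticCurves.Rank1Residual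

variable {W : WeierstrassCurve ℚ} [W.IsElliptic] [W.IsGloballyMinimal] {p : ℕ} [Fact p.Prime]

/-! ### The kernel of reduction on `E[p]` -/

omit [W.IsElliptic] [W.IsGloballyMinimal] [Fact p.Prime] in
/-- `p ∈ v` for the place `v` of `ℚ` with `primesEquiv v = p`. [folklore] -/
theorem natCast_mem_asIdeal_of_primesEquiv_eq {v : HeightOneSpectrum (𝓞 ℚ)}
    (hv : (primesEquiv v : ℕ) = p) : (p : 𝓞 ℚ) ∈ v.asIdeal := by
  rw [← hv]
  -- (as `Rat.HeightOneSpectrum.natCast_natGenerator_mem` of `SelmerCorankControlRatProofs`)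
  have h : ((natGenerator v : ℕ) : ℤ) ∈ v.asIdeal.map (Rat.IsIntegralClosure.intEquiv (𝓞 ℚ)) :=
    (natGenerator_dvd_iff v).mp dvd_rfl
  rw [← map_natCast (Rat.IsIntegralClosure.intEquiv (𝓞 ℚ)) (natGenerator v),
    Ideal.apply_mem_of_equiv_iff] at h
  exact h

variable (W p) in
/-- **`#X_p ≤ p`** for `X_p = ker (red|E[p])` at a prime `p ∤ Δ_W` of good ORDINARY reduction: the
reduction map is non-zero on `E[p]` (tree `exists_zsmul_eq_zero_geomReduction_ne_zero`, Serre 1972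
§1.11 Prop. 11 b)) and `#E[p] = p²`. [cite: Serre1972, §1.11 Prop. 11] -/
theorem natCard_ker_reduction_le (hΔ : ¬ (p : ℤ) ∣ minimalDiscriminantInt W)
    (hord : ¬ (p : ℤ) ∣ W.frobeniusTrace p) :
    Nat.card ((geomReduction hΔ).comp (geomTorsion W (p : ℤ)).subtype).ker ≤ p := by
  letI : Module (ZMod p) (geomTorsion W (p : ℤ)) := AddSubgroup.torsionBy.zmodModule
  refine card_ker_le_of_exists_ne_zero (ℓ := p) (natCard_geomTorsion W p) _ ?_
  obtain ⟨P, hP, hred⟩ := exists_zsmul_eq_zero_geomReduction_ne_zero p hΔ hord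
  exact ⟨⟨P, (Submodule.mem_torsionBy_iff _ _).mpr hP⟩, hred⟩

/-- Inertia acts trivially on `E[p]/X_p`: `τ • P - P ∈ X_p` for `τ ∈ I_𝔓` (tree
`geomReduction_smul_of_mem_inertia`). [cite: Serre1972, §1.11 Prop. 11 (proof)] -/
theorem smul_sub_self_mem_ker_of_mem_inertia (hΔ : ¬ (p : ℤ) ∣ minimalDiscriminantInt W)
    {𝔓 : Ideal (absIntegers (𝓞 ℚ) ℚ)}
    (hmem : ∀ x : absIntegers (𝓞 ℚ) ℚ, x ∈ 𝔓 ↔ (x : AlgebraicClosure ℚ) ∈ (placeOver p).nonunits)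
    {τ : absoluteGaloisGroup ℚ} (hτ : τ ∈ 𝔓.inertia (absoluteGaloisGroup ℚ))
    (P : geomTorsion W (p : ℤ)) :
    τ • P - P ∈ ((geomReduction hΔ).comp (geomTorsion W (p : ℤ)).subtype).ker := by
  rw [AddMonoidHom.mem_ker, map_sub, sub_eq_zero]
  simp only [AddMonoidHom.coe_comp, Function.comp_apply, AddSubgroup.coe_subtype,
    AddSubgroup.torsionBy.coe_smul]
  exact geomReduction_smul_of_mem_inertia hΔ hmem hτ (P : W.geomPoints)

/-- An arithmetic Frobenius acts on `E[p]/X_p` by `a_p`: `σ • P - a_p • P ∈ X_p` (gen 6,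
`geomReduction_smul_sub_frobeniusTrace_smul_eq_zero`). [cite: Serre1972, §1.11 (1)] -/
theorem smul_sub_frobeniusTrace_smul_mem_ker (hΔ : ¬ (p : ℤ) ∣ minimalDiscriminantInt W)
    {𝔓 : Ideal (absIntegers (𝓞 ℚ) ℚ)}
    (hmem : ∀ x : absIntegers (𝓞 ℚ) ℚ, x ∈ 𝔓 ↔ (x : AlgebraicClosure ℚ) ∈ (placeOver p).nonunits)
    {v : HeightOneSpectrum (𝓞 ℚ)} (hv : (primesEquiv v : ℕ) = p) (h𝔓 : 𝔓 ∈ v.primesAbove)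
    {σ : absoluteGaloisGroup ℚ} (hσ : IsArithFrobAt (𝓞 ℚ) σ 𝔓) (P : geomTorsion W (p : ℤ)) :
    σ • P - (W.frobeniusTrace p) • P ∈ ((geomReduction hΔ).comp (geomTorsion W (p : ℤ)).subtype).ker := by
  rw [AddMonoidHom.mem_ker]
  simp only [AddMonoidHom.coe_comp, Function.comp_apply, AddSubgroup.coe_subtype,
    AddSubgroupClass.coe_sub, AddSubgroup.torsionBy.coe_smul]
  exact geomReduction_smul_sub_frobeniusTrace_smul_eq_zero hΔ hmem hv h𝔓 hσ (P : W.geomPoints)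
    ((Submodule.mem_torsionBy_iff _ _).mp P.2)

/-- If `a_p ≡ 1 (mod p)`, an arithmetic Frobenius acts trivially on `E[p]/X_p`: `σ • P - P ∈ X_p`.
[cite: Serre1972, §1.11 (1)] [cite: Mazur1972, §1 (anomalous primes)] -/
theorem smul_sub_self_mem_ker_of_isArithFrobAt (hΔ : ¬ (p : ℤ) ∣ minimalDiscriminantInt W)
    {𝔓 : Ideal (absIntegers (𝓞 ℚ) ℚ)}
    (hmem : ∀ x : absIntegers (𝓞 ℚ) ℚ, x ∈ 𝔓 ↔ (x : AlgebraicClosure ℚ) ∈ (placeOver p).nonunits)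
    {v : HeightOneSpectrum (𝓞 ℚ)} (hv : (primesEquiv v : ℕ) = p) (h𝔓 : 𝔓 ∈ v.primesAbove)
    {σ : absoluteGaloisGroup ℚ} (hσ : IsArithFrobAt (𝓞 ℚ) σ 𝔓)
    (ha : (p : ℤ) ∣ W.frobeniusTrace p - 1) (P : geomTorsion W (p : ℤ)) :
    σ • P - P ∈ ((geomReduction hΔ).comp (geomTorsion W (p : ℤ)).subtype).ker := by
  rw [AddMonoidHom.mem_ker, map_sub, sub_eq_zero]
  simp only [AddMonoidHom.coe_comp, Function.comp_apply, AddSubgroup.coe_subtype,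
    AddSubgroup.torsionBy.coe_smul]
  exact geomReduction_smul_eq_self_of_dvd_frobeniusTrace_sub_one hΔ hmem hv h𝔓 hσ ha
    (P : W.geomPoints) ((Submodule.mem_torsionBy_iff _ _).mp P.2)

/-! ### The set of `g ∈ Γ_ℚ` acting trivially on `E[p]/X` is closed under products -/

omit [W.IsElliptic] [W.IsGloballyMinimal] [Fact p.Prime] in
/-- If `g` and `h` act trivially on `E[p]` modulo a subgroup `X` (`g P - P ∈ X`, `h P - P ∈ X` for
all `P`), so does `g h`: `g` preserves `X` (`g Q = Q + (g Q - Q)`), and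
`gh P - P = g (h P - P) + (g P - P)`. [folklore] -/
theorem smul_sub_self_mem_of_mul {X : AddSubgroup (geomTorsion W (p : ℤ))}
    {g h : absoluteGaloisGroup ℚ} (hg : ∀ P : geomTorsion W (p : ℤ), g • P - P ∈ X)
    (hh : ∀ P : geomTorsion W (p : ℤ), h • P - P ∈ X) (P : geomTorsion W (p : ℤ)) :
    (g * h) • P - P ∈ X := by
  have hstab : ∀ Q ∈ X, g • Q ∈ X := fun Q hQ ↦ by
    have := X.add_mem hQ (hg Q)
    rwa [add_sub_cancel] at this
  have h1 : (g * h) • P - P = g • (h • P - P) + (g • P - P) := by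
    rw [mul_smul, smul_sub]; abel
  rw [h1]
  exact X.add_mem (hstab _ (hh P)) (hg P)

omit [W.IsElliptic] [W.IsGloballyMinimal] [Fact p.Prime] in
/-- Powers: if `g` acts trivially on `E[p]/X` then so does `g ^ n`. [folklore] -/
theorem pow_smul_sub_self_mem {X : AddSubgroup (geomTorsion W (p : ℤ))}
    {g : absoluteGaloisGroup ℚ} (hg : ∀ P : geomTorsion W (p : ℤ), g • P - P ∈ X) (n : ℕ)
    (P : geomTorsion W (p : ℤ)) : (g ^ n) • P - P ∈ X := by
  induction n generalizing P with
  | zero => rw [pow_zero, one_smul, sub_self]; exact X.zero_mem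
  | succ n ih =>
    rw [pow_succ]
    exact smul_sub_self_mem_of_mul ih hg P

/-! ### The decomposition group acts trivially on `E[p]/X_p` at an anomalous prime -/

/-- **At an anomalous prime the whole decomposition group acts trivially on `E[p]/X_p`.** For
`W/ℚ` globally minimal elliptic, `p ∤ Δ_W`, `a_p ≡ 1 (mod p)` (hence ordinary), the place's prime
`𝔓` and every `g ∈ D_𝔓`: `g • P - P ∈ X_p` for all `P ∈ E[p]`. Proof: modulo the open kernel
`U = ker ρ̄_{E,p}`, `g = σⁿ τ u` (`σ` Frobenius, `τ ∈ I_𝔓`, `u ∈ U`; tree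
`exists_eq_frobenius_pow_mul_of_mem_decompositionSubgroup`); `τ`, `u` trivial on `E[p]/X_p`, `σ = a_p ≡ 1`.
[cite: Serre1972, §1.11 (1) and Prop. 11] [cite: Mazur1972, §1 (anomalous primes)] -/
theorem smul_sub_self_mem_ker_of_mem_decompositionSubgroup_of_anom
    (hΔ : ¬ (p : ℤ) ∣ minimalDiscriminantInt W)
    {𝔓 : Ideal (absIntegers (𝓞 ℚ) ℚ)}
    (hmem : ∀ x : absIntegers (𝓞 ℚ) ℚ, x ∈ 𝔓 ↔ (x : AlgebraicClosure ℚ) ∈ (placeOver p).nonunits)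
    {v : HeightOneSpectrum (𝓞 ℚ)} (hv : (primesEquiv v : ℕ) = p) (h𝔓 : 𝔓 ∈ v.primesAbove)
    (ha : (p : ℤ) ∣ W.frobeniusTrace p - 1)
    {g : absoluteGaloisGroup ℚ} (hg : g ∈ 𝔓.decompositionSubgroup (absoluteGaloisGroup ℚ))
    (P : geomTorsion W (p : ℤ)) :
    g • P - P ∈ ((geomReduction hΔ).comp (geomTorsion W (p : ℤ)).subtype).ker := by
  set X := ((geomReduction hΔ).comp (geomTorsion W (p : ℤ)).subtype).ker with hX
  obtain ⟨σ, hσ⟩ := HeightOneSpectrum.exists_isArithFrobAt_of_mem_primesAbove_holds (K := ℚ)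
    (v := v) h𝔓
  have hU : IsOpen ((galoisRepTorsion W (p : ℤ)).ker : Set (absoluteGaloisGroup ℚ)) :=
    isOpen_ker_galoisRepTorsion_holds W (n := (p : ℤ)) (by exact_mod_cast (Fact.out : p.Prime).ne_zero)
  obtain ⟨n, i, u, hi, hu, rfl⟩ :=
    exists_eq_frobenius_pow_mul_of_mem_decompositionSubgroup h𝔓 hσ hU hg
  have huP : ∀ Q : geomTorsion W (p : ℤ), u • Q - Q ∈ X := fun Q ↦ by
    have h1 : galoisRepTorsion W (p : ℤ) u = 1 := (MonoidHom.mem_ker).mp hu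
    have h2 : u • Q = Q := by
      rw [← galoisRepTorsion_apply, h1]; rfl
    rw [h2, sub_self]; exact X.zero_mem
  have hiP : ∀ Q : geomTorsion W (p : ℤ), i • Q - Q ∈ X := fun Q ↦
    smul_sub_self_mem_ker_of_mem_inertia hΔ hmem hi Q
  have hσP : ∀ Q : geomTorsion W (p : ℤ), σ • Q - Q ∈ X := fun Q ↦
    smul_sub_self_mem_ker_of_isArithFrobAt hΔ hmem hv h𝔓 hσ ha Q
  exact smul_sub_self_mem_of_mul (smul_sub_self_mem_of_mul (pow_smul_sub_self_mem hσP n) hiP) huP P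

/-! ### `X_p` is Serre's ordinary line: the inertia acts on it non-trivially -/

/-- **Some inertia element moves a point of `X_p`, and `#X_p = p`** (`p` odd, ordinary): Serre's
ordinary line `L` of `exists_ordinaryLine_of_not_dvd_frobeniusTrace` (order `p`, `(τ - 1)E[p] ⊆ L`
for `τ ∈ I_𝔓`, some `τ ∈ I_𝔓` moves `L`) meets `X_p ⊇ (τ - 1)E[p]` non-trivially, so `L = X_p`.
[cite: Serre1972, §1.11 Prop. 11 and Cor.] -/
theorem exists_mem_inertia_smul_ne_of_mem_ker (hp2 : p ≠ 2) (hΔ : ¬ (p : ℤ) ∣ minimalDiscriminantInt W)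
    (hgood : W.HasGoodReductionAtPrime p) (hord : ¬ (p : ℤ) ∣ W.frobeniusTrace p)
    {𝔓 : Ideal (absIntegers (𝓞 ℚ) ℚ)}
    (hmem : ∀ x : absIntegers (𝓞 ℚ) ℚ, x ∈ 𝔓 ↔ (x : AlgebraicClosure ℚ) ∈ (placeOver p).nonunits)
    {v : HeightOneSpectrum (𝓞 ℚ)} (hv : (primesEquiv v : ℕ) = p) (h𝔓 : 𝔓 ∈ v.primesAbove) :
    Nat.card ((geomReduction hΔ).comp (geomTorsion W (p : ℤ)).subtype).ker = p ∧
      ∃ τ ∈ 𝔓.inertia (absoluteGaloisGroup ℚ),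
        ∃ P ∈ ((geomReduction hΔ).comp (geomTorsion W (p : ℤ)).subtype).ker, τ • P ≠ P := by
  have hp : p.Prime := Fact.out
  set X := ((geomReduction hΔ).comp (geomTorsion W (p : ℤ)).subtype).ker with hX
  obtain ⟨L, hL, hLsub, τ, hτ, Q, hQL, hτQ⟩ := exists_ordinaryLine_of_not_dvd_frobeniusTrace W hp2
    hgood hord v (natCast_mem_asIdeal_of_primesEquiv_eq hv) 𝔓 h𝔓
  -- `τ Q - Q` is a non-zero element of `L ∩ X`
  have hne : τ • Q - Q ≠ 0 := fun h ↦ hτQ (sub_eq_zero.mp h)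
  have hmemX : τ • Q - Q ∈ X := smul_sub_self_mem_ker_of_mem_inertia hΔ hmem hτ Q
  have hmemL : τ • Q - Q ∈ L := hLsub τ hτ Q
  -- `L ⊓ X` is a non-trivial subgroup of `L` (order `p`), hence `= L`, so `L ≤ X`
  haveI hLfin : Finite L := Nat.finite_of_card_ne_zero (by rw [hL]; exact hp.ne_zero)
  have hLX : L ≤ X := by
    have hcard : Nat.card (L ⊓ X : AddSubgroup _) ∣ p := by
      have h := AddSubgroup.card_dvd_of_le (inf_le_left : L ⊓ X ≤ L)
      rwa [hL] at h
    rcases (Nat.dvd_prime hp).mp hcard with h1 | h2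
    · exfalso
      have hLX : τ • Q - Q ∈ (L ⊓ X : AddSubgroup _) := ⟨hmemL, hmemX⟩
      haveI : Finite (L ⊓ X : AddSubgroup _) :=
        Finite.of_injective _ (AddSubgroup.inclusion_injective (inf_le_left : L ⊓ X ≤ L))
      have hsub : (L ⊓ X : AddSubgroup _) = ⊥ := AddSubgroup.eq_bot_of_card_eq _ h1
      rw [hsub, AddSubgroup.mem_bot] at hLX
      exact hne hLX
    · have heq : (L ⊓ X : AddSubgroup _) = L := by
        haveI : Finite (L ⊓ X : AddSubgroup _) :=
        Finite.of_injective _ (AddSubgroup.inclusion_injective (inf_le_left : L ⊓ X ≤ L))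
        exact AddSubgroup.eq_of_le_of_card_ge inf_le_left (by rw [hL, h2])
      exact heq ▸ inf_le_right
  -- `#X ≤ p` and `L ≤ X` with `#L = p`: `X = L`
  have hXle : Nat.card X ≤ p := natCard_ker_reduction_le W p hΔ hord
  haveI hXfin : Finite X := by
    haveI : Finite (geomTorsion W (p : ℤ)) :=
      Nat.finite_of_card_ne_zero (by rw [natCard_geomTorsion W p]; exact pow_ne_zero 2 hp.ne_zero)
    infer_instance
  have hXL : X = L := (AddSubgroup.eq_of_le_of_card_ge hLX (by rw [hL]; exact hXle)).symm
  refine ⟨by rw [hXL, hL], τ, hτ, Q, hXL ▸ hQL, hτQ⟩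

/-! ### The dictionary -/

omit [W.IsElliptic] [W.IsGloballyMinimal] in
/-- A line `Φ` (order `p`) and a subgroup `X` of order `≤ p`: either `Φ ⊓ X = ⊥` or `Φ = X`.
[folklore] -/
theorem inf_eq_bot_or_eq_of_card {Φ X : AddSubgroup (geomTorsion W (p : ℤ))} (hΦ : Nat.card Φ = p)
    [Finite X] (hX : Nat.card X ≤ p) : Φ ⊓ X = ⊥ ∨ Φ = X := by
  have hp : p.Prime := Fact.out
  haveI : Finite Φ := Nat.finite_of_card_ne_zero (by rw [hΦ]; exact hp.ne_zero)
  haveI : Finite (Φ ⊓ X : AddSubgroup _) :=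
    Finite.of_injective _ (AddSubgroup.inclusion_injective (inf_le_left : Φ ⊓ X ≤ Φ))
  have hcard : Nat.card (Φ ⊓ X : AddSubgroup _) ∣ p := by
    have h := AddSubgroup.card_dvd_of_le (inf_le_left : Φ ⊓ X ≤ Φ)
    rwa [hΦ] at h
  rcases (Nat.dvd_prime hp).mp hcard with h1 | h2
  · exact Or.inl (AddSubgroup.eq_bot_of_card_eq _ h1)
  · right
    have heq : (Φ ⊓ X : AddSubgroup _) = Φ :=
      AddSubgroup.eq_of_le_of_card_ge inf_le_left (by rw [hΦ, h2])
    have hΦX : Φ ≤ X := heq ▸ inf_le_right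
    exact AddSubgroup.eq_of_le_of_card_ge hΦX (by rw [hΦ]; exact hX)

/-- **The dictionary, `a_p`-form.** `W/ℚ` globally minimal elliptic, `p` odd of good ORDINARY
reduction, `𝔓` the place's prime with decomposition group `D = D_𝔓 ≤ Γ_ℚ`, `Φ ⊂ E[p]` a rational
line (a `Γ_ℚ`-stable subgroup of order `p`: the kernel of a rational `p`-isogeny, character `φ`).
Then `a_p ≡ 1 (mod p)` **iff** `D` fixes `Φ` pointwise (`φ|_{G_p} = 1`) **or** `D` acts trivially
on `E[p]/Φ` (`ψ|_{G_p} = 1` for the quotient character `ψ`, i.e. `φ|_{G_p} = ω` as `φψ = det ρ̄ = ω`).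
(→) every `g ∈ D` acts trivially on `E[p]/X_p` and `Φ ⊓ X_p = ⊥` or `Φ = X_p`. (←) if `D` fixes
`Φ` then `Φ ≠ X_p` (inertia moves `X_p`) and the Frobenius fixes a point of non-zero reduction; if `D`
is trivial on `E[p]/Φ` then `Φ = X_p` and the Frobenius is trivial on `E[p]/X_p ≅ red(E[p]) ≠ 0`.
[cite: Serre1972, §1.11 (1), Prop. 11 and Cor.] [cite: CastellaGrossiSkinner2025, Thm. A (hypothesis on φ), §0 p. 3] -/
theorem dvd_frobeniusTrace_sub_one_iff_decomposition (hp2 : p ≠ 2)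
    (hgood : W.HasGoodReductionAtPrime p) (hord : ¬ (p : ℤ) ∣ W.frobeniusTrace p)
    {𝔓 : Ideal (absIntegers (𝓞 ℚ) ℚ)}
    (hmem : ∀ x : absIntegers (𝓞 ℚ) ℚ, x ∈ 𝔓 ↔ (x : AlgebraicClosure ℚ) ∈ (placeOver p).nonunits)
    {v : HeightOneSpectrum (𝓞 ℚ)} (hv : (primesEquiv v : ℕ) = p) (h𝔓 : 𝔓 ∈ v.primesAbove)
    {Φ : AddSubgroup (geomTorsion W (p : ℤ))} (hΦ : IsRationalLine W p Φ) :
    (p : ℤ) ∣ W.frobeniusTrace p - 1 ↔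
      (∀ g ∈ 𝔓.decompositionSubgroup (absoluteGaloisGroup ℚ), ∀ P ∈ Φ, g • P = P) ∨
      (∀ g ∈ 𝔓.decompositionSubgroup (absoluteGaloisGroup ℚ), ∀ P : geomTorsion W (p : ℤ),
        g • P - P ∈ Φ) := by
  have hp : p.Prime := Fact.out
  haveI : 𝔓.IsPrime := h𝔓.1
  have hΔ : ¬ (p : ℤ) ∣ minimalDiscriminantInt W :=
    W.not_dvd_minimalDiscriminantInt_of_hasGoodReductionAtPrime' p hgood
  obtain ⟨hXcard, τ, hτ, Q, hQX, hτQ⟩ :=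
    exists_mem_inertia_smul_ne_of_mem_ker hp2 hΔ hgood hord hmem hv h𝔓
  set X := ((geomReduction hΔ).comp (geomTorsion W (p : ℤ)).subtype).ker with hXdef
  haveI hXfin : Finite X := Nat.finite_of_card_ne_zero (by rw [hXcard]; exact hp.ne_zero)
  have hXle : Nat.card X ≤ p := by rw [hXcard]
  obtain ⟨σ, hσ⟩ := HeightOneSpectrum.exists_isArithFrobAt_of_mem_primesAbove_holds (K := ℚ)
    (v := v) h𝔓
  have hσD : σ ∈ 𝔓.decompositionSubgroup (absoluteGaloisGroup ℚ) := hσ.mem_stabilizer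
  have hID : 𝔓.inertia (absoluteGaloisGroup ℚ) ≤ 𝔓.decompositionSubgroup (absoluteGaloisGroup ℚ) :=
    fun x hx ↦ 𝔓.inertia_le_stabilizer hx
  -- reading membership in `X`
  have hmemX : ∀ P : geomTorsion W (p : ℤ), P ∈ X ↔ geomReduction hΔ (P : W.geomPoints) = 0 :=
    fun P ↦ by rw [hXdef, AddMonoidHom.mem_ker]; rfl
  constructor
  · -- (→)
    intro ha
    have hD : ∀ g ∈ 𝔓.decompositionSubgroup (absoluteGaloisGroup ℚ), ∀ P : geomTorsion W (p : ℤ),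
        g • P - P ∈ X := fun g hg P ↦
      smul_sub_self_mem_ker_of_mem_decompositionSubgroup_of_anom hΔ hmem hv h𝔓 ha hg P
    rcases inf_eq_bot_or_eq_of_card hΦ.1 hXle with hbot | heq
    · left
      intro g hg P hP
      have h1 : g • P - P ∈ (Φ ⊓ X : AddSubgroup _) :=
        ⟨Φ.sub_mem (hΦ.2 g P hP) hP, hD g hg P⟩
      rw [hbot, AddSubgroup.mem_bot, sub_eq_zero] at h1
      exact h1
    · right
      intro g hg P
      rw [heq]; exact hD g hg P
  · -- (←)
    rintro (hfix | hquot)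
    · -- `D` fixes `Φ`: then `Φ ≠ X` (inertia moves `X`), so `Φ ⊓ X = ⊥`
      rcases inf_eq_bot_or_eq_of_card hΦ.1 hXle with hbot | heq
      · -- a non-zero `P ∈ Φ` has non-zero reduction and is fixed by the Frobenius
        haveI : Finite Φ := Nat.finite_of_card_ne_zero (by rw [hΦ.1]; exact hp.ne_zero)
        have hnt : 1 < Nat.card Φ := by rw [hΦ.1]; exact hp.one_lt
        haveI : Nontrivial Φ := Finite.one_lt_card_iff_nontrivial.mp hnt
        obtain ⟨⟨P, hPΦ⟩, hP0⟩ := exists_ne (0 : Φ)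
        have hPX : P ∉ X := fun hPX ↦ by
          have : P ∈ (Φ ⊓ X : AddSubgroup _) := ⟨hPΦ, hPX⟩
          rw [hbot, AddSubgroup.mem_bot] at this
          exact hP0 (Subtype.ext this)
        have hred : geomReduction hΔ (P : W.geomPoints) ≠ 0 := fun h ↦ hPX ((hmemX P).mpr h)
        have hfixP : geomReduction hΔ (σ • (P : W.geomPoints)) = geomReduction hΔ (P : W.geomPoints) := by
          have h := hfix σ hσD P hPΦ
          have h' : ((σ • P : geomTorsion W (p : ℤ)) : W.geomPoints) = (P : W.geomPoints) := by rw [h]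
          rw [AddSubgroup.torsionBy.coe_smul] at h'
          rw [h']
        exact dvd_frobeniusTrace_sub_one_of_geomReduction_smul_eq_self hΔ hmem hv h𝔓 hσ
          ((Submodule.mem_torsionBy_iff _ _).mp P.2) hred hfixP
      · -- `Φ = X`: impossible, `τ ∈ I ≤ D` moves `Q ∈ X = Φ`
        exfalso
        exact hτQ (hfix τ (hID hτ) Q (heq ▸ hQX))
    · -- `D` trivial on `E[p]/Φ`
      rcases inf_eq_bot_or_eq_of_card hΦ.1 hXle with hbot | heq
      · -- `Φ ⊓ X = ⊥`: inertia would act trivially on `E[p]`, contradiction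
        exfalso
        have h1 : τ • Q - Q ∈ (Φ ⊓ X : AddSubgroup _) :=
          ⟨hquot τ (hID hτ) Q, smul_sub_self_mem_ker_of_mem_inertia hΔ hmem hτ Q⟩
        rw [hbot, AddSubgroup.mem_bot, sub_eq_zero] at h1
        exact hτQ h1
      · -- `Φ = X`: the Frobenius is trivial on `E[p]/X ≅ red(E[p]) ≠ 0`
        obtain ⟨P, hP, hred⟩ := exists_zsmul_eq_zero_geomReduction_ne_zero p hΔ hord
        set P' : geomTorsion W (p : ℤ) := ⟨P, (Submodule.mem_torsionBy_iff _ _).mpr hP⟩ with hP'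
        have h1 : σ • P' - P' ∈ X := heq ▸ hquot σ hσD P'
        have h2 : geomReduction hΔ (σ • P) = geomReduction hΔ P := by
          have h3 := (hmemX _).mp h1
          simp only [AddSubgroupClass.coe_sub, AddSubgroup.torsionBy.coe_smul, map_sub,
            sub_eq_zero] at h3
          exact h3
        exact dvd_frobeniusTrace_sub_one_of_geomReduction_smul_eq_self hΔ hmem hv h𝔓 hσ hP hred h2

/-- **The dictionary in the cell's predicates.** For `W/ℚ` globally minimal elliptic, `2 < p`,
`GoodOrd W p` (good ordinary), the place's prime `𝔓` with decomposition group `D_𝔓`, and a rational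
line `Φ` (so `red(p)`): `Anom W p ⟺ (D_𝔓 fixes Φ pointwise) ∨ (D_𝔓 acts trivially on E[p]/Φ)` —
"`a_p ≡ 1 (mod p)` iff `φ|_{G_p} ∈ {1, ω}`". [cite: Serre1972, §1.11 (1), Prop. 11 and Cor.]
[cite: CastellaGrossiSkinner2025, Thm. A (hypothesis on φ), §0 p. 3] -/
theorem anom_iff_decomposition (hp : 2 < p) (hord : GoodOrd W p)
    {𝔓 : Ideal (absIntegers (𝓞 ℚ) ℚ)}
    (hmem : ∀ x : absIntegers (𝓞 ℚ) ℚ, x ∈ 𝔓 ↔ (x : AlgebraicClosure ℚ) ∈ (placeOver p).nonunits)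
    {v : HeightOneSpectrum (𝓞 ℚ)} (hv : (primesEquiv v : ℕ) = p) (h𝔓 : 𝔓 ∈ v.primesAbove)
    {Φ : AddSubgroup (geomTorsion W (p : ℤ))} (hΦ : IsRationalLine W p Φ) :
    Anom W p ↔
      (∀ g ∈ 𝔓.decompositionSubgroup (absoluteGaloisGroup ℚ), ∀ P ∈ Φ, g • P = P) ∨
      (∀ g ∈ 𝔓.decompositionSubgroup (absoluteGaloisGroup ℚ), ∀ P : geomTorsion W (p : ℤ),
        g • P - P ∈ Φ) := by
  have hred : Red W p := fun hirr ↦ by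
    rcases hirr Φ hΦ.2 with h | h
    · have := hΦ.1; rw [h, AddSubgroup.card_bot] at this
      exact (Fact.out : p.Prime).one_lt.ne this
    · have h1 := hΦ.1
      rw [h, AddSubgroup.card_top, natCard_geomTorsion W p] at h1
      have : p ^ 2 = p ^ 1 := by rw [pow_one]; exact h1
      exact absurd (Nat.pow_right_injective (Fact.out : p.Prime).two_le this) (by norm_num)
  rw [← dvd_frobeniusTrace_sub_one_iff_decomposition (by omega) hord.1 hord.2 hmem hv h𝔓 hΦ]
  exact ⟨fun h ↦ h.2.2, fun h ↦ ⟨hred, hord.1, h⟩⟩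

/-- **Castella–Grossi–Skinner's literal hypothesis is the census predicate `¬anom(p)`** (flag
`CGS25-anom-dictionary` of the cell, in the kernel, at a good ordinary odd prime): with `Φ` the
kernel of the rational `p`-isogeny and `D_𝔓` a decomposition group at `p`,
"`φ|_{G_p} ≠ 1` and `φ|_{G_p} ≠ ω`" — rendered as: `D_𝔓` does not fix `Φ` pointwise and is not
trivial on `E[p]/Φ` — holds iff `¬ Anom W p`. [cite: CastellaGrossiSkinner2025, Thm. A (hypothesis on φ), §0 p. 3] -/
theorem not_anom_iff_cgs (hp : 2 < p) (hord : GoodOrd W p)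
    {𝔓 : Ideal (absIntegers (𝓞 ℚ) ℚ)}
    (hmem : ∀ x : absIntegers (𝓞 ℚ) ℚ, x ∈ 𝔓 ↔ (x : AlgebraicClosure ℚ) ∈ (placeOver p).nonunits)
    {v : HeightOneSpectrum (𝓞 ℚ)} (hv : (primesEquiv v : ℕ) = p) (h𝔓 : 𝔓 ∈ v.primesAbove)
    {Φ : AddSubgroup (geomTorsion W (p : ℤ))} (hΦ : IsRationalLine W p Φ) :
    ¬ Anom W p ↔
      (¬ ∀ g ∈ 𝔓.decompositionSubgroup (absoluteGaloisGroup ℚ), ∀ P ∈ Φ, g • P = P) ∧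
      (¬ ∀ g ∈ 𝔓.decompositionSubgroup (absoluteGaloisGroup ℚ), ∀ P : geomTorsion W (p : ℤ),
        g • P - P ∈ Φ) := by
  rw [anom_iff_decomposition hp hord hmem hv h𝔓 hΦ, not_or]

end Literature.NumberTheory.EllipticCurves.Rank1Residual

end
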